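import Literature.AnabelianGeometry.SemiGraphs.TemperedVerticial
import Literature.GroupTheory.SpecificGroups.PadicAffineGroup

/-!
# A kernel witness that the hypotheses of [SemiAnbd] Prop. 3.6 / Thm. 3.7 are satisfiable

Mochizuki, *Semi-graphs of anabelioids*, Publ. RIMS **42** (2006), Prop. 3.6 p. 262 and Thm. 3.7
p. 264: «Let `𝒢` be a connected, countable, quasi-coherent, totally elevated, totally aloof [resp.
estranged], verticially slim semi-graph of anabelioids».  The tree bundles these standing
hypotheses (with the author's Galois-countability erratum [IUTchI] Rmk. 2.5.3 (i) (T2) and «`𝒢` has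
a vertex») as `ProfiniteSemiGraph.Prop36Hypotheses` / `Thm37Hypotheses` (`TemperedVerticial.lean`);
every named fact and theorem of the Prop. 3.6 / Thm. 3.7 / Cor. 3.9 family quantifies over this
class.  This file certifies that the class is NOT EMPTY — so that those statements are not
vacuous — by the smallest honest model: the semi-graph with ONE vertex and NO edges whose vertex
anabelioid is `B(Aff(ℤ_p))`, `Aff(ℤ_p) = ℤ_p ⋊ ℤ_pˣ` the `p`-adic affine group
(`Literature.GroupTheory.SpecificGroups.PadicAffine`: compact, totally disconnected, SLIM, with
open normal congruence subgroups `Γ_n` of index `≥ pⁿ` forming a basis of neighbourhoods of `1`).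
For it: «connected», «countable», «has a vertex» are immediate; «of injective type», «totally
aloof», «totally estranged» are vacuous (no branches); «verticially slim» is the slimness of
`Aff(ℤ_p)`; «totally elevated» holds because the finite quotients `Aff(ℤ_p)/Γ_n` (which ARE
`π₁`-epimorphic approximators when there are no edges) have order `≥ pⁿ → ∞`; «quasi-coherent»
and «Galois-countable» hold because every finite continuous `Aff(ℤ_p)`-set is fixed pointwise by
some `Γ_n`.  KIT-RULE-style non-vacuity certificate (cell abc-iut, layer L3); no statement of the
paper is touched, strengthened or assumed.
-/

noncomputable section

namespace Literature.AnabelianGeometry.SemiGraphs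

namespace ProfiniteSemiGraph

open CategoryTheory Topology Literature.GroupTheory.SpecificGroups
open Literature.AlgebraicGeometry.Frobenioids (IsSlimGroup)

variable (p : ℕ) [Fact p.Prime]

/-! ### The one-vertex, edgeless semi-graph of anabelioids with vertex group `Aff(ℤ_p)` -/

/-- The semi-graph with one vertex, no edges, no branches. [cite: MochizukiSemiAnbd2006, §1 p.11] -/
def ptSemiGraph : SemiGraph.{0} where
  Vertex := PUnit
  Edge := PEmpty
  Branch := PEmpty
  edgeOf := fun b => nomatch b
  abuts := fun b => nomatch b
  two_branches := fun e => nomatch e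

/-- **The witness**: one vertex with anabelioid `B(Aff(ℤ_p))`, no edges.
[cite: MochizukiSemiAnbd2006, Prop 3.6 p.38] -/
def affWitness : ProfiniteSemiGraph.{0} where
  graph := ptSemiGraph
  Gv := fun _ => PadicAffine p
  Ge := fun e => nomatch e
  groupE := fun e => nomatch e
  topologicalSpaceE := fun e => nomatch e
  isTopologicalGroupE := fun e => nomatch e
  compactSpaceE := fun e => nomatch e
  totallyDisconnectedSpaceE := fun e => nomatch e
  brHom := fun b => nomatch b

variable {p}

/-- The vertex group of the witness is `Aff(ℤ_p)` (definitionally). [cite: MochizukiSemiAnbd2006, Prop 3.6 p.38] -/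
theorem affWitness_Gv (v : (affWitness p).graph.Vertex) : (affWitness p).Gv v = PadicAffine p := rfl

/-- `Aff(ℤ_p)` is tempered (it is profinite; Rmk. 3.1.1). [cite: MochizukiSemiAnbd2006, Rmk 3.1.1 p.33] -/
theorem isTempered_padicAffine : IsTempered (PadicAffine p) := IsTempered.of_profinite

/-! ### The finite quotients `Aff(ℤ_p)/Γ_n` as objects and approximators -/

/-- The finite continuous `Aff(ℤ_p)`-set `Aff(ℤ_p)/Γ_n`, an object of `B^temp(Aff(ℤ_p))` (Rmk.
3.1.2: `Π/H ∈ B^temp(Π)` iff `H` is open). [cite: MochizukiSemiAnbd2006, Rmk 3.1.2 p.33] -/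
def levelObj (n : ℕ) : BTemp (PadicAffine p) :=
  ⟨Action.ofMulAction (PadicAffine p) (PadicAffine p ⧸ PadicAffine.level p n),
    (temperedAction_quotient_iff isTempered_padicAffine (PadicAffine.level p n)).mpr
      (PadicAffine.isOpen_level n)⟩

/-- A point of `Aff(ℤ_p)/Γ_n` fixed by `g` witnesses `g ∈ Γ_n` (`Γ_n` is normal).
[cite: MochizukiSemiAnbd2006, Rmk 3.1.2 p.33] -/
theorem mem_level_of_fix (n : ℕ) (x : (levelObj (p := p) n).obj.V) (g : PadicAffine p)
    (h : (levelObj (p := p) n).obj.ρ g x = x) : g ∈ PadicAffine.level p n := by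
  change PadicAffine p ⧸ PadicAffine.level p n at x
  induction x using QuotientGroup.induction_on with
  | H y =>
    change (g • (QuotientGroup.mk y : PadicAffine p ⧸ PadicAffine.level p n)) = QuotientGroup.mk y at h
    rw [MulAction.Quotient.smul_mk, QuotientGroup.eq, smul_eq_mul, mul_inv_rev, mul_assoc] at h
    -- h : y⁻¹ * (g⁻¹ * y) ∈ Γ_n
    have h' : g⁻¹ ∈ PadicAffine.level p n := by
      have := (PadicAffine.level_normal (p := p) n).conj_mem _ h y
      simpa [mul_assoc] using this
    simpa using (PadicAffine.level p n).inv_mem h'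

/-- Every finite continuous `Aff(ℤ_p)`-set is fixed pointwise by some `Γ_n`, `n ≥ 1` (the
pointwise stabiliser is a finite intersection of open sets containing `1`).
[cite: MochizukiSemiAnbd2006, Rmk 3.1.1 p.33] -/
theorem exists_level_fixing (X : BTemp (PadicAffine p)) [Finite X.obj.V] :
    ∃ n : ℕ, 0 < n ∧ ∀ g ∈ PadicAffine.level p n, ∀ s : X.obj.V, X.obj.ρ g s = s := by
  have hopen : IsOpen {g : PadicAffine p | ∀ s : X.obj.V, X.obj.ρ g s = s} := by
    have e : {g : PadicAffine p | ∀ s : X.obj.V, X.obj.ρ g s = s} =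
        ⋂ s : X.obj.V, {g : PadicAffine p | X.obj.ρ g s = s} := by
      ext g; simp
    rw [e]
    exact isOpen_iInter_of_finite fun s => X.property.2 s
  have h1 : (1 : PadicAffine p) ∈ {g : PadicAffine p | ∀ s : X.obj.V, X.obj.ρ g s = s} := by
    intro s
    rw [map_one]
    rfl
  obtain ⟨n, hn, hsub⟩ := PadicAffine.exists_level_subset hopen h1
  exact ⟨n, hn, fun g hg s => hsub hg s⟩

/-- The **approximator at level `n`**: the finite quotient `Aff(ℤ_p) ↠ Aff(ℤ_p)/Γ_n` at the vertex
(no edges, no branches). [cite: MochizukiSemiAnbd2006, Def 2.3 pp.24-25] -/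
def levelApproximator (n : ℕ) : (affWitness p).Approximator where
  FV := fun _ => PadicAffine p ⧸ PadicAffine.level p n
  FE := fun e => nomatch e
  groupFV := fun _ => inferInstance
  finiteFV := fun _ => PadicAffine.finite_quotient_level n
  groupFE := fun e => nomatch e
  finiteFE := fun e => nomatch e
  πV := fun _ => QuotientGroup.mk' (PadicAffine.level p n)
  πE := fun e => nomatch e
  isOpen_ker_πV := fun _ => by
    change IsOpen ((QuotientGroup.mk' (PadicAffine.level p n)).ker : Set (PadicAffine p))
    rw [QuotientGroup.ker_mk']
    exact PadicAffine.isOpen_level n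
  isOpen_ker_πE := fun e => nomatch e
  brF := fun b => nomatch b
  brF_injective := fun b => nomatch b
  comm := fun b => nomatch b
  bounded := ⟨Nat.card (PadicAffine p ⧸ PadicAffine.level p n),
    @Nat.card_pos _ ⟨QuotientGroup.mk (1 : PadicAffine p)⟩
      (PadicAffine.finite_quotient_level n),
    fun _ => dvd_rfl⟩

/-- The level approximators are `π₁`-epimorphic. [cite: MochizukiSemiAnbd2006, Def 2.3(ii) p.25] -/
theorem levelApproximator_isPiOneEpimorphic (n : ℕ) :
    (levelApproximator (p := p) n).IsPiOneEpimorphic :=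
  ⟨fun _ => QuotientGroup.mk'_surjective (PadicAffine.level p n), fun e => nomatch e⟩

/-- The kernel of the level-`n` approximator at the vertex is `Γ_n`.
[cite: MochizukiSemiAnbd2006, Def 2.3 pp.24-25] -/
theorem levelApproximator_πV_eq_one_iff (n : ℕ) (v : (affWitness p).graph.Vertex)
    (g : PadicAffine p) : (levelApproximator (p := p) n).πV v g = 1 ↔ g ∈ PadicAffine.level p n := by
  change (QuotientGroup.mk' (PadicAffine.level p n)) g = 1 ↔ _
  exact QuotientGroup.eq_one_iff g

/-! ### The nine conjuncts of `Prop36Hypotheses`, and `Thm37Hypotheses` -/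

/-- Connected: the barycentric subdivision has one point. [cite: MochizukiSemiAnbd2006, §1 p.11] -/
theorem affWitness_isConnected : (affWitness p).IsConnected := by
  refine ⟨@SimpleGraph.Connected.mk _ _ ?_ ⟨Sum.inl PUnit.unit⟩⟩
  intro u v
  rcases u with u | u | u
  · rcases v with v | v | v
    · exact SimpleGraph.Reachable.refl _
    · exact nomatch v
    · exact nomatch v
  · exact nomatch u
  · exact nomatch u

/-- Countable. [cite: MochizukiSemiAnbd2006, §1 p.11] -/
theorem affWitness_isCountable : (affWitness p).IsCountable :=
  ⟨inferInstanceAs (Countable PUnit), inferInstanceAs (Countable PEmpty)⟩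

/-- Has a vertex. [cite: MochizukiSemiAnbd2006, Thm 3.7 p.40] -/
theorem affWitness_hasVertex : (affWitness p).HasVertex := ⟨PUnit.unit⟩

/-- Of injective type (no branches). [cite: MochizukiSemiAnbd2006, Def 2.1 p.22] -/
theorem affWitness_isOfInjectiveType : (affWitness p).IsOfInjectiveType := fun b => nomatch b

/-- Totally aloof (no edges). [cite: MochizukiSemiAnbd2006, Def 2.4(iv) p.26] -/
theorem affWitness_isTotallyAloof : (affWitness p).IsTotallyAloof := fun e => nomatch e

/-- Totally estranged (no edges). [cite: MochizukiSemiAnbd2006, Def 2.4(iv) p.26] -/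
theorem affWitness_isTotallyEstranged : (affWitness p).IsTotallyEstranged := fun e => nomatch e

/-- Verticially slim: `Aff(ℤ_p)` is slim. [cite: MochizukiSemiAnbd2006, Def 2.4(ii) p.25] -/
theorem affWitness_isVerticiallySlim : (affWitness p).IsVerticiallySlim :=
  fun _ => ⟨PadicAffine.centralizer_eq_bot_of_isOpen⟩

/-- Totally elevated: the approximator `Aff(ℤ_p)/Γ_M` has order `≥ p^M > M` and there is no edge
group to avoid. [cite: MochizukiSemiAnbd2006, Def 2.4(i) p.25] -/
theorem affWitness_isTotallyElevated : (affWitness p).IsTotallyElevated := by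
  intro v M
  refine ⟨levelApproximator M, levelApproximator_isPiOneEpimorphic M, ⊤, ?_, fun b => nomatch b⟩
  haveI := PadicAffine.finite_quotient_level (p := p) M
  have hp1 : 1 < p := (Fact.out : p.Prime).one_lt
  calc M ≤ p ^ M := (Nat.lt_pow_self hp1).le
    _ ≤ Nat.card (PadicAffine p ⧸ PadicAffine.level p M) := PadicAffine.pow_le_card_quotient_level M
    _ = Nat.card (⊤ : Subgroup (PadicAffine p ⧸ PadicAffine.level p M)) := Subgroup.card_top.symm

/-- Quasi-coherent: a finite continuous `Aff(ℤ_p)`-set is fixed by some `Γ_n`, i.e. split by the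
approximator of level `n`. [cite: MochizukiSemiAnbd2006, Def 2.3(iii) p.25] -/
theorem affWitness_isQuasiCoherent : (affWitness p).IsQuasiCoherent := by
  intro M HV HE hV _hE
  haveI : Finite (HV PUnit.unit).obj.V := (hV PUnit.unit).2
  obtain ⟨n, -, hfix⟩ := exists_level_fixing (p := p) (HV PUnit.unit)
  refine ⟨levelApproximator n, ?_, fun e => nomatch e⟩
  intro v g hg x
  rcases v with ⟨⟩
  exact hfix g ((levelApproximator_πV_eq_one_iff n _ g).mp hg) x

/-- The finite covering of the witness with vertex fibre `Aff(ℤ_p)/Γ_n`.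
[cite: Mochizuki2012, IUTchI Rmk 2.5.3 (i) (T2), p. 52] -/
def levelCov (n : ℕ) : CovObj (affWitness p) where
  SV := fun _ => levelObj n
  SE := fun e => nomatch e
  glue := fun b => nomatch b

/-- The level coverings are finite. [cite: Mochizuki2012, IUTchI Rmk 2.5.3 (i) (T2), p. 52] -/
theorem levelCov_isFinite (n : ℕ) : (levelCov (p := p) n).IsFinite :=
  ⟨fun _ => PadicAffine.finite_quotient_level n, fun e => nomatch e⟩

/-- The level coverings have nonempty fibres. [cite: Mochizuki2012, IUTchI Rmk 2.5.3 (i) (T2), p. 52] -/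
theorem levelCov_hasNonemptyFibres (n : ℕ) : (levelCov (p := p) n).HasNonemptyFibres :=
  ⟨fun _ => ⟨QuotientGroup.mk (1 : PadicAffine p)⟩, fun e => nomatch e⟩

/-- Galois-countable ([IUTchI] Rmk. 2.5.3 (i) (T2)): every finite covering is split, over the
vertex anabelioid, by some `Aff(ℤ_p)/Γ_n`. [cite: Mochizuki2012, IUTchI Rmk 2.5.3 (i) (T2), p. 52] -/
theorem affWitness_isGaloisCountable : (affWitness p).IsGaloisCountable := by
  refine ⟨affWitness_isCountable, levelCov, fun n => ⟨levelCov_isFinite n,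
    levelCov_hasNonemptyFibres n⟩, fun H hH => ?_⟩
  haveI : Finite (H.SV PUnit.unit).obj.V := hH.finite_V PUnit.unit
  obtain ⟨n, -, hfix⟩ := exists_level_fixing (p := p) (H.SV PUnit.unit)
  refine ⟨n, fun v x g hgx s => ?_, fun e => nomatch e⟩
  rcases v with ⟨⟩
  exact hfix g (mem_level_of_fix n x g hgx) s

/-- **The hypotheses of [SemiAnbd] Proposition 3.6 are satisfiable**: the witness satisfies
`Prop36Hypotheses`. [cite: MochizukiSemiAnbd2006, Prop 3.6 p.38] -/
theorem affWitness_prop36Hypotheses : (affWitness p).Prop36Hypotheses where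
  isConnected := affWitness_isConnected
  isCountable := affWitness_isCountable
  isGaloisCountable := affWitness_isGaloisCountable
  hasVertex := affWitness_hasVertex
  isOfInjectiveType := affWitness_isOfInjectiveType
  isQuasiCoherent := affWitness_isQuasiCoherent
  isTotallyElevated := affWitness_isTotallyElevated
  isTotallyAloof := affWitness_isTotallyAloof
  isVerticiallySlim := affWitness_isVerticiallySlim

/-- **The hypotheses of [SemiAnbd] Theorem 3.7 are satisfiable**: the witness satisfies
`Thm37Hypotheses`. [cite: MochizukiSemiAnbd2006, Thm 3.7 p.40] -/
theorem affWitness_thm37Hypotheses : (affWitness p).Thm37Hypotheses where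
  toProp36Hypotheses := affWitness_prop36Hypotheses
  isTotallyEstranged := affWitness_isTotallyEstranged

/-- Non-vacuity of the Prop. 3.6 hypothesis class (at `p = 2`).
[cite: MochizukiSemiAnbd2006, Prop 3.6 p.38] -/
theorem exists_prop36Hypotheses : ∃ 𝒢 : ProfiniteSemiGraph.{0}, 𝒢.Prop36Hypotheses :=
  ⟨@affWitness 2 ⟨Nat.prime_two⟩, @affWitness_prop36Hypotheses 2 ⟨Nat.prime_two⟩⟩

/-- Non-vacuity of the Thm. 3.7 hypothesis class (at `p = 2`).
[cite: MochizukiSemiAnbd2006, Thm 3.7 p.40] -/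
theorem exists_thm37Hypotheses : ∃ 𝒢 : ProfiniteSemiGraph.{0}, 𝒢.Thm37Hypotheses :=
  ⟨@affWitness 2 ⟨Nat.prime_two⟩, @affWitness_thm37Hypotheses 2 ⟨Nat.prime_two⟩⟩

/-- Consequently the named fact `ExistsTemperedPiChart` (Prop. 3.6 (i)–(ii)) has an instance with
satisfied hypotheses: granted it, the witness carries a tempered-fundamental-group chart.
[cite: MochizukiSemiAnbd2006, Prop 3.6(ii) p.38] -/
theorem nonempty_temperedPiChart_affWitness (h : ExistsTemperedPiChart.{0}) :
    Nonempty (TemperedPiChart (affWitness p)) :=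
  h _ affWitness_prop36Hypotheses

end ProfiniteSemiGraph

end Literature.AnabelianGeometry.SemiGraphs

end
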